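import Summits.ValiantsHypothesis.ValiantsHypothesis.Theorems.KPlusLogSqLawTropicalBStaircaseDesign

/-!
# Route `KPlusLogSqLaw`, crux `TropicalB` — THE STAIRCASE IS A TOWER: no polynomial law `2^{C·K}·m^c` holds in the
# SUPER-INCREASING sector (calibration of the tower programme; «CONJECTURE TQ» of HOME/val-sym-trop-p1/g27 is false as stated)

HONEST FRAMING.  Helper file (negative-side CALIBRATION) toward the registered stubs `stub_tropThin` / `stub_tropFat` of
`Cruxes/TropicalB/Lines/birth.lean` (crux `Summit.ValiantsHypothesis.ValiantsHypothesis.Theses.KPlusLogSqLaw.TropicalB`, ledger item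
`stmt-ValiantsHypothesis-19771`, route `KPlusLogSqLaw`; cell `pub-symmetroid`, seat val-sym-trop-p1 g28, 2026-08-29;
`--supports … --as helper`).  Nothing here proves any part of a stub and nothing asserts `TropicalB`, `KPlusLogSqLaw`,
`MatrixDescartes` (stmt-ValiantsHypothesis-18050) or anything about `VP ≠ VNP`.

THE POINT.  The cell's tower programme (memo HOME/val-sym-trop-p1/g27/TB-LANDSCAPE-g27.md §5) studies designs whose exponents are
SUPER-INCREASING BY THE SIZE — `d l < d l' → m·d l < d l'`, the hypothesis of `LexCensus.lex_census_superIncreasing` / the parity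
census — where the slope of a term determines its class histogram and the chain is a lexicographic odometer, and it conjectured
«TQ (tower-quadratic): super-increasing `d` ⇒ `n ≤ 2^{O(K)}·m²`», believing the tree's staircase family not to be a tower.  It IS one:
the staircase of `…DerivedPencilRolleStairDefs` (exponent table `DPR.expo n L = (0, Q^L, Q^{L−1}, …, Q)`, `Q = DPR.bigQ n L =
2^{L+3}(n+2)^{L+1}`) has quantum `Q` LARGER THAN ITS OWN FORMAT `m = ((2^L−1)(n+1)+1)·2^{L+1}n ≤ 2^{2L+2}n²` (`format_lt_bigQ`), so its
exponents are super-increasing by `m` (`expo_superIncreasing`), while it carries a sign-alternating dominant chain of `n^L` terms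
(`staircase_tower_chain`: the tree's `DPR.stub_stair` with the exponent vector EXPOSED, `stub_stair_expo`, pushed through the tree's
walk-design bridge with the design EXPOSED, `chain_of_walkSystem`).  Consequently (`not_towerPolyLaw`): for NO constants `C, c` does
every super-increasing design obey `n ≤ 2^{C·K}·m^c` — take `L = 2c + 1` and `n` large, exactly as in `not_tropExponentLaw`; the
tower sector has size-exponent at least `(K−1)/2`, unbounded in `K`, like the unrestricted census.  What survives: the `K = 4` instance
of TQ (the staircase with `L = 3` gives only `m^{3/2}` there) and, of course, `TropicalB` on towers (the staircase is a path design: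
`log₂ n^L = L·log₂ n ≤ log₂² m`).  Row-currency corollary: `exists_superIncreasing_not_designRowD`.

All [folklore] given the tree's theorems; the only new content is bookkeeping (exposing `d` and the design) and the arithmetic
`Q > m`.
-/

set_option linter.dupNamespace false
set_option autoImplicit false

namespace Summit.ValiantsHypothesis.ValiantsHypothesis.Theorems.KPlusLogSqLaw.WalkDesign

open Summit.ValiantsHypothesis.ValiantsHypothesis.Theorems.MatrixDescartes.Negative
open Summit.ValiantsHypothesis.ValiantsHypothesis.Theorems.LacunarySymmetroidMatrixDescartes.TropicalCensus
open Summit.ValiantsHypothesis.ValiantsHypothesis.Theorems.SymmetroidDescartes.DPR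
open scoped BigOperators
open Finset

/-! ## 1. The staircase walk system with its exponent vector exposed -/

/-- **The staircase walk system, exponents exposed** — verbatim the tree's `DPR.stub_stair` except that the exponent table is
NAMED: it is `DPR.expo n L` (class `0` flat, class `k ≥ 1` of exponent `Q^{L+1−k}`).  For `n ≥ 2` even, `L ≥ 1` and `N + 1 = n^L`:
a layered graph with `(2^L−1)(n+1)` layers on `Fin (2^L n) × Bool`, strictly increasing integer slopes `lam j`, dedicated walks
`w_j` of cost `c_j` with every other list costing `≥ c_j + 1`, and signs `(−1)^j`. [folklore, the tree's `stub_stair` proof] -/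
theorem stub_stair_expo (n L N : ℕ) (hn : 2 ≤ n) (he : Even n) (hL : 1 ≤ L) (hN : N + 1 = n ^ L) :
    ∃ (g : List (WLayer (Fin (2 ^ L * n) × Bool) (L + 1))) (v₀ : Fin (2 ^ L * n) × Bool) (lam : Fin (N + 1) → ℤ)
      (wstar : Fin (N + 1) → List (Fin (2 ^ L * n) × Bool)) (c : Fin (N + 1) → ℤ),
      g.length = (2 ^ L - 1) * (n + 1) ∧ StrictMono lam ∧
      (∀ j, walkCost (expo n L) (lam j) g v₀ (wstar j) = (c j : WithTop ℤ)) ∧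
      (∀ j (w : List (Fin (2 ^ L * n) × Bool)), w ≠ wstar j → ((c j + 1 : ℤ) : WithTop ℤ) ≤ walkCost (expo n L) (lam j) g v₀ w) ∧
      (∀ j, walkSign g v₀ (wstar j) = (-1) ^ (j : ℕ)) := by
  have hn1 : 1 ≤ n := by omega
  set R : ℕ := 2 ^ L * n with hRdef
  have hR : 0 < R := by positivity
  -- rows of the canonical walks are small
  have hrows : ∀ j, ∀ v ∈ canon n L L 0 0 j, v.1 < R := by
    intro j v hv
    have h1 := rows_canon n L L 0 0 j v hv
    have h2 := sig_le' n hn1 L j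
    have h3 : 1 ≤ 2 ^ L := Nat.one_le_two_pow
    have h4 : (2 ^ L - 1) * (n - 1) < 2 ^ L * n := by
      zify [h3, hn1]
      nlinarith
    omega
  have hmap : ∀ j, ((canon n L L 0 0 j).map (liftV R hR)).map (iota R) = canon n L L 0 0 j := by
    intro j
    rw [List.map_map]
    conv_rhs => rw [← List.map_id (canon n L L 0 0 j)]
    refine List.map_congr_left fun v hv => ?_
    exact iota_liftV R hR v (hrows j v hv)
  refine ⟨(gad n L L 0).map (finLayer R), (⟨0, hR⟩, false), fun j => lamOf n L j,
    fun j => (canon n L L 0 0 j).map (liftV R hR), fun j => val n L L 0 0 j (lamOf n L j),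
    ?_, ?_, ?_, ?_, ?_⟩
  · rw [List.length_map, length_gad n L hn1]
  · intro a b hab
    exact lamOf_lt n L hn1 a b hab (by rw [← hN]; exact b.isLt)
  · intro j
    rw [walkCost_finLayer, hmap]
    exact walkCost_canon n L hn1 _ L le_rfl 0 0 j
  · intro j w hw
    rw [walkCost_finLayer]
    have hne : w.map (iota R) ≠ canon n L L 0 0 j := by
      intro h
      apply hw
      rw [← hmap j] at h
      exact (List.map_injective_iff.2 (iota_injective R)) h
    have hlaw := law_all n L hn1 L le_rfl 0 0 j (lamOf n L j) (by simp) (by simpa using layers_le_Rtot n L)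
      (inCore_lamOf n L j) _ hne
    have hg := one_le_gapZ_top n L
    refine le_trans ?_ hlaw
    exact_mod_cast (by linarith : val n L L 0 0 j (lamOf n L j) + 1 ≤ val n L L 0 0 j (lamOf n L j) + gapZ n L L)
  · intro j
    rw [walkSign_finLayer, hmap]
    show walkSign (gad n L L 0) (0, false) (canon n L L 0 0 j) = (-1) ^ (j : ℕ)
    rw [walkSign_canon_top n L hn1 hL]
    conv_rhs => rw [← Nat.div_add_mod (j : ℕ) n, pow_add, pow_mul, Even.neg_one_pow he, one_pow, one_mul]

/-! ## 2. The bridge with the design exposed -/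

section Bridge

variable {V : Type*} {K : ℕ} (d : Fin K → ℕ) [Fintype V] [DecidableEq V]

/-- **The bridge, design exposed** — verbatim the tree's `le_of_walkSystem` up to its last step: a unique-walk system with
exponent table `d` on a layered graph `g` over the finite vertex type `V` IS a sign-alternating dominant chain of `N + 1` terms, at
the SAME slopes `lam`, of an explicit design WITH THE SAME EXPONENTS `d` on `(T+1)·|V|` nodes whose signs have absolute value `≤ 1`
(the walk design `walkVal` / `walkEps` of `…WalkDesignDefs`). [folklore, the tree's `le_of_walkSystem` proof] -/
theorem chain_of_walkSystem (hK : 0 < K) (g : List (WLayer V K)) (hT : 0 < g.length) (v₀ : V) {N : ℕ}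
    (lam : Fin (N + 1) → ℤ) (wstar : Fin (N + 1) → List V) (c : Fin (N + 1) → ℤ)
    (hcost : ∀ j, walkCost d (lam j) g v₀ (wstar j) = ((c j : ℤ) : WithTop ℤ))
    (hmarg : ∀ j (w : List V), w ≠ wstar j → ((c j + 1 : ℤ) : WithTop ℤ) ≤ walkCost d (lam j) g v₀ w)
    (hsign : ∀ j, walkSign g v₀ (wstar j) = (-1) ^ (j : ℕ)) :
    ∃ (v ε : Fin ((g.length + 1) * Fintype.card V) → Fin ((g.length + 1) * Fintype.card V) → Fin K → ℤ)
      (p : Fin (N + 1) → Equiv.Perm (Fin ((g.length + 1) * Fintype.card V)) × (Fin ((g.length + 1) * Fintype.card V) → Fin K)),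
      (∀ i j l, (ε i j l).natAbs ≤ 1) ∧ (∀ k, IsDominant d v ε (lam k) (p k)) ∧
      (∀ k : Fin N, termSign ε (p k.castSucc) * termSign ε (p k.succ) < 0) := by
  classical
  set T := g.length with hTdef
  set lay : Fin T → V → V → Option (WEdge K) := g.get with hlay
  set l₀ : Fin K := ⟨0, hK⟩ with hl₀
  -- the index equivalence
  set ι : Fin (T + 1) × V ≃ Fin ((T + 1) * Fintype.card V) :=
    (Equiv.prodCongr (Equiv.refl (Fin (T + 1))) (Fintype.equivFin V)).trans finProdFinEquiv with hι
  -- the vertex sequences of the dedicated walks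
  have hne : ∀ j, walkCost d (lam j) g v₀ (wstar j) ≠ ⊤ := fun j => by rw [hcost]; exact WithTop.coe_ne_top
  choose y hy0 hys hyw using fun j => exists_walk_of_walkCost_ne_top d (lam j) g v₀ (wstar j) (hne j)
  have hwalk : ∀ j, IsLayWalk lay v₀ (y j) := fun j => ⟨hy0 j, hys j⟩
  have hcostFin : ∀ j, walkCostFin d lay (lam j) (y j) = c j := by
    intro j
    have h1 := walkCost_ofFn d (lam j) g (y j) (hys j)
    rw [hy0 j, hyw j, hcost j] at h1
    exact (WithTop.coe_eq_coe.mp h1).symm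
  have hsgnFin : ∀ j, walkSgnFin lay (y j) = (-1) ^ (j : ℕ) := by
    intro j
    have h1 := walkSign_ofFn g (y j)
    rw [hy0 j, hyw j, hsign j] at h1
    exact h1.symm
  -- the bonus beating the identity term
  set Ω : ℤ := 1 + ∑ j, (|c j| + (T : ℤ) * |lam j| * (d l₀ : ℤ)) with hΩ
  have hΩj : ∀ j, walkCostFin d lay (lam j) (y j) + (T : ℤ) * (lam j * (d l₀ : ℤ)) < Ω := by
    intro j
    rw [hcostFin]
    have h1 : |c j| + (T : ℤ) * |lam j| * (d l₀ : ℤ) ≤ ∑ j, (|c j| + (T : ℤ) * |lam j| * (d l₀ : ℤ)) :=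
      Finset.single_le_sum (f := fun j => |c j| + (T : ℤ) * |lam j| * (d l₀ : ℤ))
        (fun i _ => by positivity) (mem_univ j)
    have h2 : c j ≤ |c j| := le_abs_self _
    have h3 : (T : ℤ) * (lam j * (d l₀ : ℤ)) ≤ (T : ℤ) * |lam j| * (d l₀ : ℤ) := by
      have : lam j * (d l₀ : ℤ) ≤ |lam j| * (d l₀ : ℤ) :=
        mul_le_mul_of_nonneg_right (le_abs_self _) (by positivity)
      nlinarith
    omega
  -- the chain
  set p : Fin (N + 1) → Equiv.Perm (Fin ((T + 1) * Fintype.card V)) × (Fin ((T + 1) * Fintype.card V) → Fin K) :=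
    fun j => walkTerm ι lay l₀ (y j) with hp
  refine ⟨walkVal ι lay Ω v₀, walkEps ι lay l₀ v₀, p, ?_, ?_, ?_⟩
  · intro a b l
    exact natAbs_walkEpsP_le_one lay l₀ v₀ _ _ l
  · intro j
    refine isDominant_walkTerm lay l₀ v₀ ι d Ω (lam j) hT (hwalk j) (hΩj j) fun y' hy' hne' => ?_
    -- a competitor walk is a competitor list
    have hw' : (List.ofFn fun s : Fin T => y' s.succ) ≠ wstar j := by
      intro h
      apply hne'
      exact eq_of_ofFn_eq (hy'.1.trans (hy0 j).symm) (h.trans (hyw j).symm)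
    have h1 := hmarg j _ hw'
    rw [← hy'.1, walkCost_ofFn d (lam j) g y' hy'.2] at h1
    · rw [hcostFin]
      have := WithTop.coe_le_coe.mp h1
      exact this
  · intro j
    rw [alternate_walkTerm_iff lay l₀ v₀ ι hT (hwalk _) (hwalk _), hsgnFin, hsgnFin]
    simp only [Fin.val_castSucc, Fin.val_succ, pow_succ]
    have : ((-1 : ℤ) ^ (j : ℕ)) * ((-1 : ℤ) ^ (j : ℕ)) = 1 := by rw [← mul_pow]; norm_num
    nlinarith

end Bridge

/-! ## 3. The quantum exceeds the format: the staircase exponents are super-increasing by the size -/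

/-- `Q = 2^{L+3}(n+2)^{L+1}` exceeds the staircase format `((2^L−1)(n+1)+1)·2^{L+1}n` (`n, L ≥ 1`). [folklore] -/
theorem format_lt_bigQ (n L : ℕ) (hn : 1 ≤ n) (hL : 1 ≤ L) :
    ((2 ^ L - 1) * (n + 1) + 1) * (2 ^ L * n * 2) < bigQ n L := by
  have hfmt := staircase_format_le n L hn
  unfold bigQ
  -- `2^{2L+2} n² < 2^{L+3} (n+2)^{L+1}`: with `L = L'+1`, `2^{L'} n² < (n+2)^{L'} (n+2)²`
  obtain ⟨L', rfl⟩ : ∃ L', L = L' + 1 := ⟨L - 1, by omega⟩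
  have h1 : 2 ^ L' ≤ (n + 2) ^ L' := Nat.pow_le_pow_left (by omega) L'
  have h2 : n ^ 2 < (n + 2) ^ 2 := by nlinarith
  have h3 : 2 ^ L' * n ^ 2 < (n + 2) ^ L' * (n + 2) ^ 2 :=
    calc 2 ^ L' * n ^ 2 < 2 ^ L' * (n + 2) ^ 2 := Nat.mul_lt_mul_of_pos_left h2 (by positivity)
      _ ≤ (n + 2) ^ L' * (n + 2) ^ 2 := Nat.mul_le_mul_right _ h1
  have h4 : 2 ^ (2 * (L' + 1) + 2) * n ^ 2 < 2 ^ (L' + 1 + 3) * (n + 2) ^ (L' + 1 + 1) := by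
    calc 2 ^ (2 * (L' + 1) + 2) * n ^ 2 = 2 ^ (L' + 4) * (2 ^ L' * n ^ 2) := by ring
      _ < 2 ^ (L' + 4) * ((n + 2) ^ L' * (n + 2) ^ 2) := Nat.mul_lt_mul_of_pos_left h3 (by positivity)
      _ = 2 ^ (L' + 1 + 3) * (n + 2) ^ (L' + 1 + 1) := by ring
  omega

/-- value of the exponent table off class `0`. [folklore] -/
theorem expo_of_ne_zero (n L : ℕ) (l : Fin (L + 1)) (hl : l.val ≠ 0) : expo n L l = bigQ n L ^ (L + 1 - l.val) := by
  unfold expo slopeP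
  rw [if_neg hl]

/-- value of the exponent table at class `0`. [folklore] -/
theorem expo_of_eq_zero (n L : ℕ) (l : Fin (L + 1)) (hl : l.val = 0) : expo n L l = 0 := by
  unfold expo
  rw [if_pos hl]

/-- **THE STAIRCASE IS A TOWER**: its exponents are super-increasing by its own format —
`expo l < expo l' → m · expo l < expo l'` with `m = ((2^L−1)(n+1)+1)·2^{L+1}n` (`n, L ≥ 1`). [folklore] -/
theorem expo_superIncreasing (n L : ℕ) (hn : 1 ≤ n) (hL : 1 ≤ L) (l l' : Fin (L + 1)) (h : expo n L l < expo n L l') :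
    ((2 ^ L - 1) * (n + 1) + 1) * (2 ^ L * n * 2) * expo n L l < expo n L l' := by
  set m := ((2 ^ L - 1) * (n + 1) + 1) * (2 ^ L * n * 2) with hm
  have hQ : m < bigQ n L := format_lt_bigQ n L hn hL
  have hm1 : 1 ≤ m := by
    rw [hm]
    have h1 : 1 ≤ 2 ^ L := Nat.one_le_two_pow
    have h2 : 1 ≤ 2 ^ L * n * 2 := by
      have : 1 ≤ 2 ^ L * n := le_trans h1 (Nat.le_mul_of_pos_right _ (by omega))
      omega
    exact le_trans h2 (Nat.le_mul_of_pos_left _ (by omega))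
  have hQ1 : 1 < bigQ n L := by omega
  by_cases hl : l.val = 0
  · rw [expo_of_eq_zero n L l hl, Nat.mul_zero]
    rw [expo_of_eq_zero n L l hl] at h
    exact h
  · have hl' : l'.val ≠ 0 := by
      intro h0
      rw [expo_of_eq_zero n L l' h0] at h
      exact Nat.not_lt_zero _ h
    rw [expo_of_ne_zero n L l hl, expo_of_ne_zero n L l' hl'] at h ⊢
    -- `Q^a < Q^b` forces `a + 1 ≤ b`, and `m·Q^a < Q·Q^a = Q^{a+1} ≤ Q^b`
    have hab : L + 1 - l.val < L + 1 - l'.val := (Nat.pow_lt_pow_iff_right hQ1).mp h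
    calc m * bigQ n L ^ (L + 1 - l.val) < bigQ n L * bigQ n L ^ (L + 1 - l.val) :=
          Nat.mul_lt_mul_of_pos_right hQ (by positivity)
      _ = bigQ n L ^ (L + 1 - l.val + 1) := by ring
      _ ≤ bigQ n L ^ (L + 1 - l'.val) := Nat.pow_le_pow_right (by omega) (by omega)

/-! ## 4. The tower chain and the refutation of the polynomial tower law -/

/-- **THE STAIRCASE TOWER CHAIN.**  For `n ≥ 2` even and `L ≥ 1`: an explicit design of format `(m, L+1)`,
`m = ((2^L−1)(n+1)+1)·2^{L+1}n`, with the SUPER-INCREASING exponent table `DPR.expo n L` and signs in `{−1,0,1}`, carrying a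
sign-alternating dominant chain of `n^L` terms at strictly increasing integer slopes. [folklore, from the tree's staircase] -/
theorem staircase_tower_chain (n L : ℕ) (hn : 2 ≤ n) (he : Even n) (hL : 1 ≤ L) :
    ∃ (v ε : Fin (((2 ^ L - 1) * (n + 1) + 1) * (2 ^ L * n * 2)) → Fin (((2 ^ L - 1) * (n + 1) + 1) * (2 ^ L * n * 2)) →
        Fin (L + 1) → ℤ)
      (θ : Fin (n ^ L - 1 + 1) → ℤ)
      (p : Fin (n ^ L - 1 + 1) → Equiv.Perm (Fin (((2 ^ L - 1) * (n + 1) + 1) * (2 ^ L * n * 2))) ×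
        (Fin (((2 ^ L - 1) * (n + 1) + 1) * (2 ^ L * n * 2)) → Fin (L + 1))),
      (∀ i j l, (ε i j l).natAbs ≤ 1) ∧ StrictMono θ ∧ (∀ k, IsDominant (expo n L) v ε (θ k) (p k)) ∧
      (∀ k : Fin (n ^ L - 1), termSign ε (p k.castSucc) * termSign ε (p k.succ) < 0) := by
  classical
  have hN : n ^ L - 1 + 1 = n ^ L := Nat.sub_add_cancel (Nat.one_le_pow _ _ (by omega))
  obtain ⟨g, v₀, lam, wstar, c, hlen, hlam, hcost, hmarg, hsign⟩ := stub_stair_expo n L (n ^ L - 1) hn he hL hN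
  have hT : 0 < g.length := by
    rw [hlen]
    have : 1 ≤ 2 ^ L - 1 := by
      have : 2 ≤ 2 ^ L := by
        calc 2 = 2 ^ 1 := by norm_num
          _ ≤ 2 ^ L := Nat.pow_le_pow_right (by norm_num) hL
      omega
    positivity
  have hcard : (g.length + 1) * Fintype.card (Fin (2 ^ L * n) × Bool) = ((2 ^ L - 1) * (n + 1) + 1) * (2 ^ L * n * 2) := by
    rw [Fintype.card_prod, Fintype.card_fin, Fintype.card_bool, hlen]
  obtain ⟨v, ε, p, hε, hdom, halt⟩ :=
    chain_of_walkSystem (expo n L) (Nat.succ_pos L) g hT v₀ lam wstar c hcost hmarg hsign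
  -- transport along the equality of formats
  revert v ε p
  rw [hcard]
  intro v ε p hε hdom halt
  exact ⟨v, ε, lam, p, hε, hlam, hdom, halt⟩

/-- **NO POLYNOMIAL TOWER LAW** («CONJECTURE TQ» of the cell's tower memo, in every polynomial degree, is FALSE as stated): for no
constants `C, c` is it true that every design of every format `(m, K)` whose exponents are super-increasing by the size
(`d l < d l' → m·d l < d l'`) and whose signs are in `{−1,0,1}` has all its sign-alternating dominant chains (strictly increasing
integer slopes) of length `≤ 2^{C·K}·m^c`.  Witness: the staircase tower with `L = 2c + 1` levels and
`n = 2·(2^{C(L+1)}·(2^{2L+2})^c) + 2`. [folklore, from `staircase_tower_chain`] -/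
theorem not_towerPolyLaw (C c : ℕ) :
    ¬ (∀ (m K : ℕ) (d : Fin K → ℕ) (v ε : Fin m → Fin m → Fin K → ℤ),
        (∀ l l' : Fin K, d l < d l' → m * d l < d l') → (∀ i j l, (ε i j l).natAbs ≤ 1) →
        ∀ (N : ℕ) (θ : Fin (N + 1) → ℤ) (p : Fin (N + 1) → Equiv.Perm (Fin m) × (Fin m → Fin K)),
          StrictMono θ → (∀ k, IsDominant d v ε (θ k) (p k)) →
          (∀ k : Fin N, termSign ε (p k.castSucc) * termSign ε (p k.succ) < 0) → N ≤ 2 ^ (C * K) * m ^ c) := by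
  intro hlaw
  set L := 2 * c + 1 with hL
  set A := 2 ^ (C * (L + 1)) * (2 ^ (2 * L + 2)) ^ c with hA
  set n := 2 * A + 2 with hn
  have hn2 : 2 ≤ n := by omega
  have hne : Even n := ⟨A + 1, by omega⟩
  set m := ((2 ^ L - 1) * (n + 1) + 1) * (2 ^ L * n * 2) with hm
  obtain ⟨v, ε, θ, p, hε, hθ, hdom, halt⟩ := staircase_tower_chain n L hn2 hne (by omega)
  have h1 : n ^ L - 1 ≤ 2 ^ (C * (L + 1)) * m ^ c :=
    hlaw m (L + 1) (expo n L) v ε (fun l l' h => expo_superIncreasing n L (by omega) (by omega) l l' h) hε _ θ p hθ hdom halt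
  -- `2^{C(L+1)}·m^c ≤ A·n^{2c}`
  have hm' : m ≤ 2 ^ (2 * L + 2) * n ^ 2 := staircase_format_le n L (by omega)
  have h2 : 2 ^ (C * (L + 1)) * m ^ c ≤ A * n ^ (2 * c) := by
    calc 2 ^ (C * (L + 1)) * m ^ c ≤ 2 ^ (C * (L + 1)) * (2 ^ (2 * L + 2) * n ^ 2) ^ c :=
          Nat.mul_le_mul_left _ (Nat.pow_le_pow_left hm' c)
      _ = A * n ^ (2 * c) := by rw [hA, mul_pow, ← pow_mul]; ring
  -- `n^L = n^{2c}·n ≥ n^{2c}·(A + 2)`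
  have h3 : n ^ L = n ^ (2 * c) * n := by rw [hL, pow_succ]
  have h4 : 1 ≤ n ^ (2 * c) := Nat.one_le_pow _ _ (by omega)
  have h5 : n ^ L - 1 ≤ A * n ^ (2 * c) := h1.trans h2
  rw [h3] at h5
  have : n ^ (2 * c) * n ≤ A * n ^ (2 * c) + 1 := by omega
  nlinarith

/-- **Row-currency corollary**: for every `C, c` some design with super-increasing exponents and signs in `{−1,0,1}` VIOLATES
the unsigned per-design row `DesignRowD d v ε (2^{C·K}·m^c)` of `…TropicalBSplitDefs` (a sign-alternating chain has pairwise
distinct consecutive terms). [folklore] -/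
theorem exists_superIncreasing_not_designRowD (C c : ℕ) :
    ∃ (m K : ℕ) (d : Fin K → ℕ) (v ε : Fin m → Fin m → Fin K → ℤ),
      (∀ l l' : Fin K, d l < d l' → m * d l < d l') ∧ (∀ i j l, (ε i j l).natAbs ≤ 1) ∧
      ¬ DesignRowD d v ε (2 ^ (C * K) * m ^ c) := by
  by_contra hcon
  push Not at hcon
  refine not_towerPolyLaw C c fun m K d v ε hsup hε N θ p hθ hdom halt => ?_
  refine hcon m K d v ε hsup hε N θ p hθ hdom fun k heq => ?_
  have := halt k
  rw [heq] at this
  exact absurd this (not_lt.mpr (mul_self_nonneg _))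

/-! ## 5. The K-resolved form: at `K = L+1` classes the tower sector beats every bound `A·m^c` with `2c + 1 ≤ L`
(appended 2026-08-29, same seat): so the size-exponent of the super-increasing sector at `K` classes is at least `(K−1)/2`, and the
QUADRATIC tower law «`n ≤ A·m²`» fails at every `K ≥ 6` (it is untouched at `K = 4, 5`, where the staircase gives `m^{3/2}`, `≈ m²/2^{20}`). -/

/-- **NO BOUND `A·m^c` AT `K = L + 1` CLASSES IN THE SUPER-INCREASING SECTOR WHEN `2c + 1 ≤ L`**: for no constant `A` is it true that
every design of format `(m, L+1)` with exponents super-increasing by the size and signs in `{−1,0,1}` has all its sign-alternating dominant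
chains of length `≤ A·m^c`.  Witness: the staircase tower with `n = 2·A·(2^{2L+2})^c + 2` (`n^L ≥ n^{2c+1} > A·(2^{2L+2}n²)^c`).
[folklore, from `staircase_tower_chain`] -/
theorem not_towerPowLaw_fixedK (A c L : ℕ) (hL : 2 * c + 1 ≤ L) :
    ¬ (∀ (m : ℕ) (d : Fin (L + 1) → ℕ) (v ε : Fin m → Fin m → Fin (L + 1) → ℤ),
        (∀ l l' : Fin (L + 1), d l < d l' → m * d l < d l') → (∀ i j l, (ε i j l).natAbs ≤ 1) →
        ∀ (N : ℕ) (θ : Fin (N + 1) → ℤ) (p : Fin (N + 1) → Equiv.Perm (Fin m) × (Fin m → Fin (L + 1))),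
          StrictMono θ → (∀ k, IsDominant d v ε (θ k) (p k)) →
          (∀ k : Fin N, termSign ε (p k.castSucc) * termSign ε (p k.succ) < 0) → N ≤ A * m ^ c) := by
  intro hlaw
  set A' := A * (2 ^ (2 * L + 2)) ^ c with hA'
  set n := 2 * A' + 2 with hn
  have hn2 : 2 ≤ n := by omega
  have hne : Even n := ⟨A' + 1, by omega⟩
  have hL1 : 1 ≤ L := by omega
  set m := ((2 ^ L - 1) * (n + 1) + 1) * (2 ^ L * n * 2) with hm
  obtain ⟨v, ε, θ, p, hε, hθ, hdom, halt⟩ := staircase_tower_chain n L hn2 hne hL1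
  have h1 : n ^ L - 1 ≤ A * m ^ c :=
    hlaw m (expo n L) v ε (fun l l' h => expo_superIncreasing n L (by omega) hL1 l l' h) hε _ θ p hθ hdom halt
  -- `A·m^c ≤ A'·n^{2c}`
  have hm' : m ≤ 2 ^ (2 * L + 2) * n ^ 2 := staircase_format_le n L (by omega)
  have h2 : A * m ^ c ≤ A' * n ^ (2 * c) := by
    calc A * m ^ c ≤ A * (2 ^ (2 * L + 2) * n ^ 2) ^ c := Nat.mul_le_mul_left _ (Nat.pow_le_pow_left hm' c)
      _ = A' * n ^ (2 * c) := by rw [hA', mul_pow, ← pow_mul]; ring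
  -- `n^L ≥ n^{2c+1} = n^{2c}·n`
  have h3 : n ^ (2 * c) * n ≤ n ^ L := by
    rw [← pow_succ]; exact Nat.pow_le_pow_right (by omega) hL
  have h4 : 1 ≤ n ^ (2 * c) := Nat.one_le_pow _ _ (by omega)
  have h5 : n ^ (2 * c) * n - 1 ≤ A' * n ^ (2 * c) := le_trans (Nat.sub_le_sub_right h3 1) (h1.trans h2)
  have : n ^ (2 * c) * n ≤ A' * n ^ (2 * c) + 1 := by omega
  nlinarith

/-- **THE QUADRATIC TOWER LAW FAILS AT EVERY `K ≥ 6`** (the cell's «TQ», K-resolved): for `6 ≤ K` and every constant `A` some design of format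
`(m, K)` with super-increasing exponents and signs in `{−1,0,1}` carries a sign-alternating dominant chain longer than `A·m²`.
(`K = 4, 5` are untouched by the staircase.) [folklore, `not_towerPowLaw_fixedK` with `c = 2`, `L = K − 1 ≥ 5`] -/
theorem not_towerQuadraticLaw_of_six_le (K A : ℕ) (hK : 6 ≤ K) :
    ¬ (∀ (m : ℕ) (d : Fin K → ℕ) (v ε : Fin m → Fin m → Fin K → ℤ),
        (∀ l l' : Fin K, d l < d l' → m * d l < d l') → (∀ i j l, (ε i j l).natAbs ≤ 1) →
        ∀ (N : ℕ) (θ : Fin (N + 1) → ℤ) (p : Fin (N + 1) → Equiv.Perm (Fin m) × (Fin m → Fin K)),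
          StrictMono θ → (∀ k, IsDominant d v ε (θ k) (p k)) →
          (∀ k : Fin N, termSign ε (p k.castSucc) * termSign ε (p k.succ) < 0) → N ≤ A * m ^ 2) := by
  obtain ⟨L, rfl⟩ : ∃ L, K = L + 1 := ⟨K - 1, by omega⟩
  exact not_towerPowLaw_fixedK A 2 L (by omega)

end Summit.ValiantsHypothesis.ValiantsHypothesis.Theorems.KPlusLogSqLaw.WalkDesign
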